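import Literature.AlgebraicGeometry.HodgeTheory.ComplexTorusHodgeGeneralLefschetzSummandsEndomorphisms
import Literature.AlgebraicGeometry.HodgeTheory.ComplexTorusHodgeGeneralCorrespondenceAlgebraBlocks
import Literature.AlgebraicGeometry.HodgeTheory.ComplexTorusHodgeGeneralHodgeEndomorphismAlgebraBlocksAboveMiddle
import Literature.AlgebraicGeometry.HodgeTheory.ComplexTorusHodgeGeneralSubHodgeStructures
import Literature.AlgebraicGeometry.ModuliOfAbelianVarieties.SiegelFamilyHodgeGroupType
import Literature.AlgebraicGeometry.ModuliOfAbelianVarieties.SiegelLevelModuli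
import HarnessLib

/-!
# The general polarized abelian variety OF EVERY TYPE `δ = (d₁, …, d_g)` (Siegel family `X^δ_Z = ℂᵍ/(Z, Δ)ℤ^{2g}`): off Lange's meagre Hodge-group exceptional locus `𝒩_Hg ⊂ 𝔥_g` the
# Hodge motive `h(X_Z)` is the UNIQUE, multiplicity-free sum of its `#KunnemannIndex(g)` simple pieces, `Bᵍ(X_Z × X_Z) ≅ Dᵍ ≅ ℚ^{#KunnemannIndex(g)}`,
# `End_Hdg(Hˢ(X_Z, ℚ)) ≅ ℚ^{⌊s/2⌋+1}`, the Lefschetz pieces `Lʳ H^m(X_Z, ℚ)_prim` have `End_Hdg = ℚ` and `Hom_Hdg = 0` between them — and these `Z` are dense in `𝔥_g`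

Layer `Literature/AlgebraicGeometry/HodgeTheory`, namespace `Literature.AlgebraicGeometry.HodgeTheory.ComplexTorusCat`; lane `lit-hodgefound` (Track 2 foundations
library), prover seat `lit-hodgefound-p35` (gen 46, row g46-#7; the type-`δ` twin of g46-#6 `…HodgeGeneralSiegelFamilyMotives`). THEOREMS ONLY (no definition, no named fact, net debt 0).

The A4 layer formalises Lange's Prop. 7.3.2 "For a general polarized abelian variety `(X, E)`, `Hg(X) = Sp(V, E)`" for EVERY polarization type
(`ModuliOfAbelianVarieties/SiegelFamilyHodgeGroupType`: `hodgeGroup_eq_spGroup_of_not_mem_type` — off the SAME meagre locus `hodgeGroupExceptionalLocus g ⊂ 𝔥_g` the torus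
`X^δ_Z` presented by `siegelPeriodEquiv hδ Z.2` with its Riemann form `siegelForm hδ Z.2` of type `δ` has `Hg = Sp`; the complement is dense, `dense_compl_hodgeGroupExceptionalLocus`). ✔ g46-#1/#2/#3 proved, for every complex torus of positive dimension with a Riemann form `θ` and `Hg(X) = Sp(V, θ)`, the structure
of the algebra of Hodge correspondences `Bᵍ(X × X)`, of `End_Hdg(Hˢ(X, ℚ))` and of the Lefschetz pieces. THIS FILE reads them on the members `X^δ_Z` of the
Siegel family of type `δ` (the object `ComplexTorusCat.of ⟨Fin g ⊕ Fin g, ℂᵍ, siegelPeriodEquiv hδ Z.2⟩`, `θ = siegelForm hδ Z.2`), `Z ∉ 𝒩_Hg`, `g ≥ 1`: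

* §1 `End_Hdg(Hˢ(X_Z, ℚ)) ≅ ℚ^{⌊s/2⌋+1}` as `ℚ`-algebras (`s ≤ g`); `End_Hdg(Lʳ H^m(X_Z, ℚ)_prim) = ℚ` (`= ⊥`, `dim = 1`) and `Hom_Hdg(Lʳ H^m_prim, L^{r′} H^{m′}_prim) = 0` for `r ≠ r′`
  (`2r + m = 2r′ + m′ = k ≤ g`).
* §2 (any ring frame `(f, f′)` of p08's algebra, `f` positively oriented): `Bᵍ(X_Z × X_Z) ≅ ℚ^{KunnemannIndex(g)} ≅ Dᵍ(X_Z × X_Z)` as `ℚ`-algebras; `h(X_Z)` is MULTIPLICITY-FREE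
  (`(X_Z, p) ≅ (X_Z, q) ⟺ p = q`); it has exactly `#KunnemannIndex(g) = Σ_{s ≤ 2g} (⌊min(s, 2g−s)/2⌋ + 1)` simple sub-motives and `2^{#KunnemannIndex(g)}` sub-motives in Hodge
  correspondences; ITS DECOMPOSITION INTO SIMPLE HODGE MOTIVES IS UNIQUE, with exactly `⌊min(s, 2g−s)/2⌋ + 1` members of each weight `s`; and every decomposition of the
  `ℚ`-Hodge structure `Hˢ(X_Z, ℚ)` into indecomposable sub-Hodge structures has `⌊min(s, 2g−s)/2⌋ + 1` members.
* §3 DENSITY in `𝔥_g` of the `Z` with each of these properties (Prop. 7.3.2, `Dense.mono`).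
* §4 (✔ g46-#5 above the middle, ✔ g45-#9) EVERY WEIGHT `s ≤ 2g`: `End_Hdg(Hˢ) ≅ ℚ^{⌊min(s, 2g−s)/2⌋+1}`, `⌊min(s, 2g−s)/2⌋ + 1` blocks = primitive idempotents, `2^{…}` idempotents
  = `2^{…}` sub-Hodge structures, the decomposition of `Hˢ` into indecomposable sub-Hodge structures is UNIQUE and its members are the Lefschetz summands `Lʳ H^{s−2r}_prim`;
  a rational subspace of `Hᵏ` is a sub-Hodge structure iff it is a sum of Lefschetz pieces (✔ g45-#9); density of these `Z`, and
  Prop. 7.3.2 as printed: the `Z` with all these properties form a RESIDUAL subset of `𝔥_g` (`Filter.Eventually` along `residual`).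

NOT restated: Prop. 7.3.2 itself and the locus (A4), the torus-level theorems (✔ g46-#1/#2/#3), the principal case (g46-#6).

## The sources, verbatim (held texts, re-read for this row)

* H. Lange, *Abelian Varieties over the Complex Numbers* (Springer 2023), held `book:lange1992-complex-abelian-varieties`, §7.3.1 Prop. 7.3.2 (p0336 L21): "For a general polarized
  abelian variety `(X, E)`, `Hg(X) = Sp(V, E)`" (p0336 L7–L20: "general" = outside a countable union of proper analytic subsets of the Siegel upper half space); §7.3.2 (1)–(3)
  (p0338 L3–L16) ("pairwise non-isomorphic irreducible `Sp_{2g}(ℚ)`-representations"); §7.2.2 Thm. 7.2.4 (p0331); §8.1 (the Siegel family `X_Z = ℂᵍ/(Z, 1_g)ℤ^{2g}`).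
* T. Y. Lam, *A First Course in Noncommutative Rings* (2nd ed. 2001), §22 Prop. (22.1) and p. 325 (p0325 L9–L24).
* B. Kahn, *Zeta and L-Functions of Varieties and Motives* (CUP 2020), §6.7 Thm. 6.20, §6.12.2 Cor. 6.42, App. A Thm. A.6 (p0135).
* C. Voisin, *Hodge Theory and Complex Algebraic Geometry I* (CUP 2002), §7.1.2, §7.3.1 Cor. 7.24.
* J. S. Milne, *Lefschetz classes on abelian varieties*, Duke Math. J. 96 (1999), §5 p. 664, Thm. 5.9.
* K. Künnemann, *A Lefschetz decomposition for Chow motives of abelian schemes*, Invent. Math. 113 (1993) — not held; through Milne §5 and Murre §7.18.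

## References
* [Lange2023AbelianVarietiesComplex] H. Lange, Abelian Varieties over the Complex Numbers, Springer 2023 — §7.3.1 Prop. 7.3.2 (p0336), §7.3.2 (1)–(3) (p0338), §7.2.2 Thm. 7.2.4 (p0331), §8.1.
* [Lam2001FirstCourse] T. Y. Lam, A First Course in Noncommutative Rings, 2nd ed., Springer GTM 131, 2001 — §22 Prop. (22.1), p. 325; §21 (21.6)–(21.7).
* [Kahn2020] B. Kahn, Zeta and L-Functions of Varieties and Motives, LMS LN 462, CUP 2020 — §6.7 Thm. 6.20, §6.12.2 Cor. 6.42, App. A Thm. A.6 (p0135).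
* [VoisinHodgeI2002] C. Voisin, Hodge Theory and Complex Algebraic Geometry I, CUP 2002 — §7.1.2, §7.3.1 Cor. 7.24.
* [Milne1999LefschetzClasses] J. S. Milne, Lefschetz classes on abelian varieties, Duke Math. J. 96 (1999) — §5 p. 664, Thm. 5.9.
* [Kunnemann1993] K. Künnemann, A Lefschetz decomposition for Chow motives of abelian schemes, Invent. Math. 113 (1993) 85–102 (not held; through Milne §5 and Murre §7.18).
-/

noncomputable section

open CategoryTheory Function Module

namespace Literature.AlgebraicGeometry.HodgeTheory

open Literature.AlgebraicGeometry.Motives Literature.AlgebraicGeometry.Motives.HodgeStructure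
open Literature.Geometry.Kaehler Literature.Geometry.Kaehler.ComplexTorus
open Literature.AlgebraicGeometry.ModuliOfAbelianVarieties Literature.AlgebraicGeometry.ModuliOfAbelianVarieties.SiegelModuli
open Literature.NumberTheory.Automorphic (siegelUpperHalfSpace)
open Literature.RingTheory.Idempotents

namespace ComplexTorusCat

open scoped Classical

-- `↥End_Hdg ⊂ End_ℚ(↥Hˢ(X, ℚ))` and the sub-Hodge structures `Lʳ H^m_prim ⊂ Hᵏ(X, ℚ)` are several coercions deep (as in ✔ g45-#10, ✔ g46-#2)
set_option maxSynthPendingDepth 3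
set_option synthInstance.maxHeartbeats 200000

variable {g : ℕ}

/-- `dim_ℂ ℂᵍ = g` for the member `X_Z` of the Siegel family, as an object of `ComplexTorusCat`. [cite: Lange2023AbelianVarietiesComplex, §8.1 (p0213)] -/
private theorem finrank_prin₆₆ {δ : Fin g → ℕ} (hδ : ∀ i, 0 < δ i) (Z : siegelUpperHalfSpace g) : finrank ℂ (ComplexTorusCat.of ⟨Fin g ⊕ Fin g, Fin g → ℂ, siegelPeriodEquiv hδ Z.2⟩).toIsog.E = g :=
  Module.finrank_fin_fun ℂ

/-! ## §1 `End_Hdg(Hˢ(X_Z, ℚ))` and the Lefschetz pieces of a general member -/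

/-- **OFF `𝒩_Hg`: `End_Hdg(Hˢ(X_Z, ℚ)) ≅ ℚ × ⋯ × ℚ` (`⌊s/2⌋ + 1` factors) AS `ℚ`-ALGEBRAS** for the general principally polarized abelian variety `X_Z` and every `s ≤ g` (✔ g46-#1 §6 + Prop. 7.3.2).
[cite: Lange2023AbelianVarietiesComplex, §7.3.1 Prop. 7.3.2 (p0336), §7.2.2 Thm. 7.2.4 (p0331) and §7.3.2 (1)–(3) (p0338 L3–L16)] [cite: Lam2001FirstCourse, §22 Prop. (22.1), p. 325] [cite: Kahn2020, §6.7 Thm. 6.20, §6.12.2 Cor. 6.42 and App. A Thm. A.6 (p0135)] [cite: Kunnemann1993] [cite: GoodmanWallachGTM255, §5.5.1 Cor. 5.5.9 (5.54)] -/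
theorem nonempty_endAlg_hodgeStructure_siegelPeriodEquiv_algEquiv_pi_of_not_mem_hodgeGroupExceptionalLocus (hg : 0 < g) {δ : Fin g → ℕ} (hδ : ∀ i, 0 < δ i) {Z : siegelUpperHalfSpace g} (hZ : Z ∉ hodgeGroupExceptionalLocus g) {s : ℕ} (hs : s ≤ g) :
    Nonempty ((hodgeStructure (siegelPeriodEquiv hδ Z.2) s).endAlg ≃ₐ[ℚ] (Fin (s / 2 + 1) → ℚ)) :=
  nonempty_endAlg_hodgeStructure_algEquiv_pi_of_isRiemannForm_of_hodgeGroup_eq_spGroup (ComplexTorusCat.of ⟨Fin g ⊕ Fin g, Fin g → ℂ, siegelPeriodEquiv hδ Z.2⟩) (θ := (⟨siegelForm hδ Z.2, (mem_neronSeveriGroup_iff _).2 (isRiemannForm_siegelForm hδ Z.2).isNSForm⟩ : neronSeveriGroup (siegelPeriodEquiv hδ Z.2))) (isRiemannForm_siegelForm hδ Z.2) (hodgeGroup_eq_spGroup_of_not_mem_type hδ hZ)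
    (by rw [finrank_prin₆₆]; exact hg) (by rw [finrank_prin₆₆]; exact hs)

/-- **OFF `𝒩_Hg`: `End_Hdg(Lʳ H^m(X_Z, ℚ)_prim) = ℚ`** (`= ⊥ ⊂ End_ℚ`; `2r + m = k ≤ g`) — the pieces of the rational Lefschetz decomposition of the principal polarization `E_Z` of a general member
have only scalar Hodge endomorphisms (✔ g46-#2 §3 + Prop. 7.3.2). [cite: Lange2023AbelianVarietiesComplex, §7.3.1 Prop. 7.3.2 (p0336) and §7.3.2 (3) (p0338 L12–L16)] [cite: VoisinHodgeI2002, §7.1.2 and §7.3.1 Cor. 7.24] [cite: Lam2001FirstCourse, §21 (21.6)–(21.7)] [cite: Kunnemann1993] -/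
theorem endAlg_lefschetzSummandSubHodgeStructure_siegelPeriodEquiv_eq_bot_of_not_mem_hodgeGroupExceptionalLocus (hg : 0 < g) {δ : Fin g → ℕ} (hδ : ∀ i, 0 < δ i) {Z : siegelUpperHalfSpace g} (hZ : Z ∉ hodgeGroupExceptionalLocus g) {r m k : ℕ} (hm : 2 * r + m = k) (hk : k ≤ g) :
    ((isRiemannForm_siegelForm hδ Z.2).isNSForm.lefschetzSummandSubHodgeStructure (siegelPeriodEquiv hδ Z.2) r hm).toHodgeStructure.endAlg = ⊥ :=
  endAlg_lefschetzSummandSubHodgeStructure_eq_bot_of_isRiemannForm_of_hodgeGroup_eq_spGroup (ComplexTorusCat.of ⟨Fin g ⊕ Fin g, Fin g → ℂ, siegelPeriodEquiv hδ Z.2⟩) (θ := (⟨siegelForm hδ Z.2, (mem_neronSeveriGroup_iff _).2 (isRiemannForm_siegelForm hδ Z.2).isNSForm⟩ : neronSeveriGroup (siegelPeriodEquiv hδ Z.2))) (isRiemannForm_siegelForm hδ Z.2) (hodgeGroup_eq_spGroup_of_not_mem_type hδ hZ) (by rw [finrank_prin₆₆]; exact hg) hm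
    (by rw [finrank_prin₆₆]; exact hk)

/-- **OFF `𝒩_Hg`: `dim_ℚ End_Hdg(Lʳ H^m(X_Z, ℚ)_prim) = 1`** (`2r + m = k ≤ g`). [cite: Lange2023AbelianVarietiesComplex, §7.3.1 Prop. 7.3.2 (p0336) and §7.3.2 (3) (p0338 L12–L16)] [cite: VoisinHodgeI2002, §7.1.2 and §7.3.1 Cor. 7.24] [cite: Lam2001FirstCourse, §21 (21.6)–(21.7)] [cite: Kunnemann1993] -/
theorem finrank_endAlg_lefschetzSummandSubHodgeStructure_siegelPeriodEquiv_of_not_mem_hodgeGroupExceptionalLocus (hg : 0 < g) {δ : Fin g → ℕ} (hδ : ∀ i, 0 < δ i) {Z : siegelUpperHalfSpace g} (hZ : Z ∉ hodgeGroupExceptionalLocus g) {r m k : ℕ} (hm : 2 * r + m = k) (hk : k ≤ g) :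
    finrank ℚ ((isRiemannForm_siegelForm hδ Z.2).isNSForm.lefschetzSummandSubHodgeStructure (siegelPeriodEquiv hδ Z.2) r hm).toHodgeStructure.endAlg = 1 :=
  finrank_endAlg_lefschetzSummandSubHodgeStructure_of_isRiemannForm_of_hodgeGroup_eq_spGroup (ComplexTorusCat.of ⟨Fin g ⊕ Fin g, Fin g → ℂ, siegelPeriodEquiv hδ Z.2⟩) (θ := (⟨siegelForm hδ Z.2, (mem_neronSeveriGroup_iff _).2 (isRiemannForm_siegelForm hδ Z.2).isNSForm⟩ : neronSeveriGroup (siegelPeriodEquiv hδ Z.2))) (isRiemannForm_siegelForm hδ Z.2) (hodgeGroup_eq_spGroup_of_not_mem_type hδ hZ) (by rw [finrank_prin₆₆]; exact hg) hm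
    (by rw [finrank_prin₆₆]; exact hk)

/-- **OFF `𝒩_Hg`: `Hom_Hdg(Lʳ H^m(X_Z, ℚ)_prim, L^{r′} H^{m′}(X_Z, ℚ)_prim) = 0` for `r ≠ r′`** (both inside `Hᵏ(X_Z, ℚ)`, `k ≤ g`): the Lefschetz pieces of a general member are pairwise non-isomorphic
`ℚ`-Hodge structures (✔ g46-#2 §3 + Prop. 7.3.2). [cite: Lange2023AbelianVarietiesComplex, §7.3.1 Prop. 7.3.2 (p0336) and §7.3.2 (3) (p0338 L12–L16)] [cite: VoisinHodgeI2002, §7.1.2 and §7.3.1 Cor. 7.24] [cite: Lam2001FirstCourse, §21 (21.6)–(21.7)] [cite: Kunnemann1993] -/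
theorem hom_lefschetzSummandSubHodgeStructure_siegelPeriodEquiv_eq_zero_of_ne_of_not_mem_hodgeGroupExceptionalLocus (hg : 0 < g) {δ : Fin g → ℕ} (hδ : ∀ i, 0 < δ i) {Z : siegelUpperHalfSpace g} (hZ : Z ∉ hodgeGroupExceptionalLocus g) {r r' m m' k : ℕ} (hm : 2 * r + m = k)
    (hm' : 2 * r' + m' = k) (hrr : r ≠ r') (hk : k ≤ g) (B : Hom ((isRiemannForm_siegelForm hδ Z.2).isNSForm.lefschetzSummandSubHodgeStructure (siegelPeriodEquiv hδ Z.2) r hm).toHodgeStructure ((isRiemannForm_siegelForm hδ Z.2).isNSForm.lefschetzSummandSubHodgeStructure (siegelPeriodEquiv hδ Z.2) r' hm').toHodgeStructure) : B = 0 :=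
  hom_lefschetzSummandSubHodgeStructure_eq_zero_of_ne_of_isRiemannForm_of_hodgeGroup_eq_spGroup (ComplexTorusCat.of ⟨Fin g ⊕ Fin g, Fin g → ℂ, siegelPeriodEquiv hδ Z.2⟩) (θ := (⟨siegelForm hδ Z.2, (mem_neronSeveriGroup_iff _).2 (isRiemannForm_siegelForm hδ Z.2).isNSForm⟩ : neronSeveriGroup (siegelPeriodEquiv hδ Z.2))) (isRiemannForm_siegelForm hδ Z.2) (hodgeGroup_eq_spGroup_of_not_mem_type hδ hZ) (by rw [finrank_prin₆₆]; exact hg) hm hm' hrr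
    (by rw [finrank_prin₆₆]; exact hk) B

/-- **… in particular no Lefschetz piece embeds into another one as a `ℚ`-Hodge structure.** [cite: Lange2023AbelianVarietiesComplex, §7.3.1 Prop. 7.3.2 (p0336) and §7.3.2 (3) (p0338 L12–L16)] [cite: VoisinHodgeI2002, §7.1.2 and §7.3.1 Cor. 7.24] [cite: Lam2001FirstCourse, §21 (21.6)–(21.7)] [cite: Kunnemann1993] -/
theorem not_injective_hom_lefschetzSummandSubHodgeStructure_siegelPeriodEquiv_of_ne_of_not_mem_hodgeGroupExceptionalLocus (hg : 0 < g) {δ : Fin g → ℕ} (hδ : ∀ i, 0 < δ i) {Z : siegelUpperHalfSpace g} (hZ : Z ∉ hodgeGroupExceptionalLocus g) {r r' m m' k : ℕ} (hm : 2 * r + m = k)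
    (hm' : 2 * r' + m' = k) (hrr : r ≠ r') (hk : k ≤ g) (B : Hom ((isRiemannForm_siegelForm hδ Z.2).isNSForm.lefschetzSummandSubHodgeStructure (siegelPeriodEquiv hδ Z.2) r hm).toHodgeStructure ((isRiemannForm_siegelForm hδ Z.2).isNSForm.lefschetzSummandSubHodgeStructure (siegelPeriodEquiv hδ Z.2) r' hm').toHodgeStructure) : ¬ Injective B.toLinearMap :=
  not_injective_hom_lefschetzSummandSubHodgeStructure_of_ne_of_isRiemannForm_of_hodgeGroup_eq_spGroup (ComplexTorusCat.of ⟨Fin g ⊕ Fin g, Fin g → ℂ, siegelPeriodEquiv hδ Z.2⟩) (θ := (⟨siegelForm hδ Z.2, (mem_neronSeveriGroup_iff _).2 (isRiemannForm_siegelForm hδ Z.2).isNSForm⟩ : neronSeveriGroup (siegelPeriodEquiv hδ Z.2))) (isRiemannForm_siegelForm hδ Z.2) (hodgeGroup_eq_spGroup_of_not_mem_type hδ hZ) (by rw [finrank_prin₆₆]; exact hg) hm hm' hrr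
    (by rw [finrank_prin₆₆]; exact hk) B

/-! ## §2 The Hodge motive `h(X_Z)` of a general member: `Bᵍ(X_Z × X_Z) ≅ ℚ^{KunnemannIndex(g)}`, multiplicity-free, unique decomposition, the counts -/

/-- **OFF `𝒩_Hg`: `Bᵍ(X_Z × X_Z) ≅ ℚ^{KunnemannIndex(g)}` AS `ℚ`-ALGEBRAS** — the endomorphism algebra of the Hodge motive of the general principally polarized abelian variety is split commutative of dimension
`Σ_{s ≤ 2g} (⌊min(s, 2g−s)/2⌋ + 1)` (any positively oriented ring frame `(f, f′)` of p08's `CorrRing.hodgeCorr`; ✔ g46-#1 §6 + Prop. 7.3.2). [cite: Lange2023AbelianVarietiesComplex, §7.3.1 Prop. 7.3.2 (p0336), §7.2.2 Thm. 7.2.4 (p0331) and §7.3.2 (1)–(3) (p0338 L3–L16)] [cite: Lam2001FirstCourse, §22 Prop. (22.1), p. 325] [cite: Kahn2020, §6.7 Thm. 6.20, §6.12.2 Cor. 6.42 and App. A Thm. A.6 (p0135)] [cite: Kunnemann1993] -/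
theorem nonempty_hodgeCorr_siegelPeriodEquiv_algEquiv_pi_of_not_mem_hodgeGroupExceptionalLocus (hg : 0 < g) {δ : Fin g → ℕ} (hδ : ∀ i, 0 < δ i) {Z : siegelUpperHalfSpace g} (hZ : Z ∉ hodgeGroupExceptionalLocus g) (f : Fin (g + g) ≃ Fin g ⊕ Fin g) (hf : orientationSign (siegelPeriodEquiv hδ Z.2) f = 1)
    (f' : Fin ((g + g) + (g + g)) ≃ (Fin g ⊕ Fin g) ⊕ (Fin g ⊕ Fin g)) :
    Nonempty (CorrRing.hodgeCorr (siegelPeriodEquiv hδ Z.2) f hf f' ≃ₐ[ℚ] (KunnemannIndex g → ℚ)) :=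
  nonempty_hodgeCorr_algEquiv_pi_of_isRiemannForm_of_hodgeGroup_eq_spGroup (ComplexTorusCat.of ⟨Fin g ⊕ Fin g, Fin g → ℂ, siegelPeriodEquiv hδ Z.2⟩) (θ := (⟨siegelForm hδ Z.2, (mem_neronSeveriGroup_iff _).2 (isRiemannForm_siegelForm hδ Z.2).isNSForm⟩ : neronSeveriGroup (siegelPeriodEquiv hδ Z.2))) (isRiemannForm_siegelForm hδ Z.2) (hodgeGroup_eq_spGroup_of_not_mem_type hδ hZ) hg f hf f'

/-- **OFF `𝒩_Hg`: Milne's `Dᵍ(X_Z × X_Z) ≅ ℚ^{KunnemannIndex(g)}` AS `ℚ`-ALGEBRAS** (`Hg = Sp ⟹ End_ℚ(X_Z) = ℚ ⟹ Lf = Sp`). [cite: Milne1999LefschetzClasses, §5 p. 664, Prop. 5.7, Cor. 5.8, Thm. 5.9] [cite: Lange2023AbelianVarietiesComplex, §7.3.1 Prop. 7.3.2 (p0336), §7.2.2 Thm. 7.2.4 (p0331) and §7.3.2 (1)–(3) (p0338 L3–L16)] [cite: Lam2001FirstCourse, §22 Prop. (22.1), p. 325] [cite: Kahn2020, §6.7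 Thm. 6.20, §6.12.2 Cor. 6.42 and App. A Thm. A.6 (p0135)] [cite: Kunnemann1993] -/
theorem nonempty_lefschetzCorr_siegelPeriodEquiv_algEquiv_pi_of_not_mem_hodgeGroupExceptionalLocus (hg : 0 < g) {δ : Fin g → ℕ} (hδ : ∀ i, 0 < δ i) {Z : siegelUpperHalfSpace g} (hZ : Z ∉ hodgeGroupExceptionalLocus g) (f : Fin (g + g) ≃ Fin g ⊕ Fin g) (hf : orientationSign (siegelPeriodEquiv hδ Z.2) f = 1)
    (f' : Fin ((g + g) + (g + g)) ≃ (Fin g ⊕ Fin g) ⊕ (Fin g ⊕ Fin g)) :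
    Nonempty (CorrRing.lefschetzCorr (siegelPeriodEquiv hδ Z.2) f hf f' (isRiemannForm_siegelForm hδ Z.2) ≃ₐ[ℚ] (KunnemannIndex g → ℚ)) :=
  nonempty_lefschetzCorr_algEquiv_pi_of_isRiemannForm_of_endAlgRat_eq_bot (ComplexTorusCat.of ⟨Fin g ⊕ Fin g, Fin g → ℂ, siegelPeriodEquiv hδ Z.2⟩) (θ := (⟨siegelForm hδ Z.2, (mem_neronSeveriGroup_iff _).2 (isRiemannForm_siegelForm hδ Z.2).isNSForm⟩ : neronSeveriGroup (siegelPeriodEquiv hδ Z.2))) (isRiemannForm_siegelForm hδ Z.2) ((isRiemannForm_siegelForm hδ Z.2).endAlgRat_eq_bot_of_hodgeGroup_eq_spGroup (hodgeGroup_eq_spGroup_of_not_mem_type hδ hZ)) hg f hf f'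

/-- **OFF `𝒩_Hg`: `h(X_Z)` IS MULTIPLICITY-FREE** — two sub-motives `(X_Z, p)`, `(X_Z, q)` cut out by projectors of `Bᵍ(X_Z × X_Z)` are isomorphic (`p = ab`, `q = ba`) iff `p = q` (✔ g46-#3 §1 + Prop. 7.3.2).
[cite: Lam2001FirstCourse, §21 Prop. (21.20) and §22 p. 325, p. 328] [cite: Lange2023AbelianVarietiesComplex, §7.3.1 Prop. 7.3.2 (p0336), §7.2.2 Thm. 7.2.4 (p0331) and §7.3.2 (1)–(3) (p0338 L3–L16)] [cite: Lam2001FirstCourse, §22 Prop. (22.1), p. 325] [cite: Kahn2020, §6.7 Thm. 6.20, §6.12.2 Cor. 6.42 and App. A Thm. A.6 (p0135)] [cite: Kunnemann1993] -/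
theorem isIsoIdempotent_hodgeCorr_siegelPeriodEquiv_iff_eq_of_not_mem_hodgeGroupExceptionalLocus {δ : Fin g → ℕ} (hδ : ∀ i, 0 < δ i) {Z : siegelUpperHalfSpace g}
    (hZ : Z ∉ hodgeGroupExceptionalLocus g) (f : Fin (g + g) ≃ Fin g ⊕ Fin g) (hf : orientationSign (siegelPeriodEquiv hδ Z.2) f = 1)
    (f' : Fin ((g + g) + (g + g)) ≃ (Fin g ⊕ Fin g) ⊕ (Fin g ⊕ Fin g))
    {p q : CorrRing.hodgeCorr (siegelPeriodEquiv hδ Z.2) f hf f'} (hp : IsIdempotentElem p) : IsIsoIdempotent p q ↔ p = q :=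
  isIsoIdempotent_hodgeCorr_iff_eq_of_hodgeGroup_eq_spGroup (siegelPeriodEquiv hδ Z.2) (isRiemannForm_siegelForm hδ Z.2) (hodgeGroup_eq_spGroup_of_not_mem_type hδ hZ) f hf f' hp

/-- **OFF `𝒩_Hg`: `h(X_Z)` HAS EXACTLY `#KunnemannIndex(g) = Σ_{s ≤ 2g} (⌊min(s, 2g−s)/2⌋ + 1)` SIMPLE SUB-MOTIVES in Hodge correspondences** (primitive idempotents of `Bᵍ(X_Z × X_Z)`; `6`, `10`, `15` for the general
abelian surface, threefold, fourfold; ✔ g46-#3 §4 + Prop. 7.3.2). [cite: Lange2023AbelianVarietiesComplex, §7.3.1 Prop. 7.3.2 (p0336), §7.2.2 Thm. 7.2.4 (p0331) and §7.3.2 (1)–(3) (p0338 L3–L16)] [cite: Lam2001FirstCourse, §22 Prop. (22.1), p. 325] [cite: Kahn2020, §6.7 Thm. 6.20, §6.12.2 Cor. 6.42 and App. A Thm. A.6 (p0135)] [cite: Kunnemann1993] -/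
theorem ncard_setOf_isPrimitiveIdempotent_hodgeCorr_siegelPeriodEquiv_of_not_mem_hodgeGroupExceptionalLocus (hg : 0 < g) {δ : Fin g → ℕ} (hδ : ∀ i, 0 < δ i) {Z : siegelUpperHalfSpace g} (hZ : Z ∉ hodgeGroupExceptionalLocus g) (f : Fin (g + g) ≃ Fin g ⊕ Fin g) (hf : orientationSign (siegelPeriodEquiv hδ Z.2) f = 1)
    (f' : Fin ((g + g) + (g + g)) ≃ (Fin g ⊕ Fin g) ⊕ (Fin g ⊕ Fin g)) :
    {z : CorrRing.hodgeCorr (siegelPeriodEquiv hδ Z.2) f hf f' | IsPrimitiveIdempotent z}.ncard = Fintype.card (KunnemannIndex g) :=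
  ncard_setOf_isPrimitiveIdempotent_hodgeCorr_of_isRiemannForm_of_hodgeGroup_eq_spGroup (ComplexTorusCat.of ⟨Fin g ⊕ Fin g, Fin g → ℂ, siegelPeriodEquiv hδ Z.2⟩) (θ := (⟨siegelForm hδ Z.2, (mem_neronSeveriGroup_iff _).2 (isRiemannForm_siegelForm hδ Z.2).isNSForm⟩ : neronSeveriGroup (siegelPeriodEquiv hδ Z.2))) (isRiemannForm_siegelForm hδ Z.2) (hodgeGroup_eq_spGroup_of_not_mem_type hδ hZ) hg f hf f'

/-- **OFF `𝒩_Hg`: `Bᵍ(X_Z × X_Z)` has exactly `#KunnemannIndex(g)` blocks.** [cite: Lange2023AbelianVarietiesComplex, §7.3.1 Prop. 7.3.2 (p0336), §7.2.2 Thm. 7.2.4 (p0331) and §7.3.2 (1)–(3) (p0338 L3–L16)] [cite: Lam2001FirstCourse, §22 Prop. (22.1), p. 325] [cite: Kahn2020, §6.7 Thm. 6.20, §6.12.2 Cor. 6.42 and App. A Thm. A.6 (p0135)] [cite: Kunnemann1993] -/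
theorem ncard_setOf_isCentrallyPrimitive_hodgeCorr_siegelPeriodEquiv_of_not_mem_hodgeGroupExceptionalLocus (hg : 0 < g) {δ : Fin g → ℕ} (hδ : ∀ i, 0 < δ i) {Z : siegelUpperHalfSpace g} (hZ : Z ∉ hodgeGroupExceptionalLocus g) (f : Fin (g + g) ≃ Fin g ⊕ Fin g) (hf : orientationSign (siegelPeriodEquiv hδ Z.2) f = 1)
    (f' : Fin ((g + g) + (g + g)) ≃ (Fin g ⊕ Fin g) ⊕ (Fin g ⊕ Fin g)) :
    {z : CorrRing.hodgeCorr (siegelPeriodEquiv hδ Z.2) f hf f' | IsCentrallyPrimitive z}.ncard = Fintype.card (KunnemannIndex g) :=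
  ncard_setOf_isCentrallyPrimitive_hodgeCorr_of_isRiemannForm_of_hodgeGroup_eq_spGroup (ComplexTorusCat.of ⟨Fin g ⊕ Fin g, Fin g → ℂ, siegelPeriodEquiv hδ Z.2⟩) (θ := (⟨siegelForm hδ Z.2, (mem_neronSeveriGroup_iff _).2 (isRiemannForm_siegelForm hδ Z.2).isNSForm⟩ : neronSeveriGroup (siegelPeriodEquiv hδ Z.2))) (isRiemannForm_siegelForm hδ Z.2) (hodgeGroup_eq_spGroup_of_not_mem_type hδ hZ) hg f hf f'

/-- **OFF `𝒩_Hg`: `h(X_Z)` has exactly `2^{#KunnemannIndex(g)}` sub-motives in Hodge correspondences** (idempotents of `Bᵍ(X_Z × X_Z)`; `64` for the general abelian surface).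
[cite: Lam2001FirstCourse, §22 Prop. (22.1) (1) and (3), p. 325] [cite: Lange2023AbelianVarietiesComplex, §7.3.1 Prop. 7.3.2 (p0336), §7.2.2 Thm. 7.2.4 (p0331) and §7.3.2 (1)–(3) (p0338 L3–L16)] [cite: Lam2001FirstCourse, §22 Prop. (22.1), p. 325] [cite: Kahn2020, §6.7 Thm. 6.20, §6.12.2 Cor. 6.42 and App. A Thm. A.6 (p0135)] [cite: Kunnemann1993] -/
theorem ncard_setOf_isIdempotentElem_hodgeCorr_siegelPeriodEquiv_of_not_mem_hodgeGroupExceptionalLocus (hg : 0 < g) {δ : Fin g → ℕ} (hδ : ∀ i, 0 < δ i) {Z : siegelUpperHalfSpace g} (hZ : Z ∉ hodgeGroupExceptionalLocus g) (f : Fin (g + g) ≃ Fin g ⊕ Fin g) (hf : orientationSign (siegelPeriodEquiv hδ Z.2) f = 1)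
    (f' : Fin ((g + g) + (g + g)) ≃ (Fin g ⊕ Fin g) ⊕ (Fin g ⊕ Fin g)) :
    {z : CorrRing.hodgeCorr (siegelPeriodEquiv hδ Z.2) f hf f' | IsIdempotentElem z}.ncard = 2 ^ Fintype.card (KunnemannIndex g) :=
  ncard_setOf_isIdempotentElem_hodgeCorr_of_isRiemannForm_of_hodgeGroup_eq_spGroup (ComplexTorusCat.of ⟨Fin g ⊕ Fin g, Fin g → ℂ, siegelPeriodEquiv hδ Z.2⟩) (θ := (⟨siegelForm hδ Z.2, (mem_neronSeveriGroup_iff _).2 (isRiemannForm_siegelForm hδ Z.2).isNSForm⟩ : neronSeveriGroup (siegelPeriodEquiv hδ Z.2))) (isRiemannForm_siegelForm hδ Z.2) (hodgeGroup_eq_spGroup_of_not_mem_type hδ hZ) hg f hf f'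

/-- **OFF `𝒩_Hg`: THE DECOMPOSITION OF `h(X_Z)` INTO SIMPLE HODGE MOTIVES IS UNIQUE** (it is Künnemann's; ✔ g46-#3 §4 + Prop. 7.3.2). [cite: Lam2001FirstCourse, §22 Prop. (22.1) (3), p. 325] [cite: Lange2023AbelianVarietiesComplex, §7.3.1 Prop. 7.3.2 (p0336), §7.2.2 Thm. 7.2.4 (p0331) and §7.3.2 (1)–(3) (p0338 L3–L16)] [cite: Lam2001FirstCourse, §22 Prop. (22.1), p. 325] [cite: Kahn2020, §6.7 Thm. 6.20, §6.12.2 Cor. 6.42 and App. A Thm. A.6 (p0135)] [cite: Kunnemann1993]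
[cite: GreenMurreVoisin1994, Murre §7.18 (3) (p0128 L9)] -/
theorem existsUnique_isPrimitiveDecomposition_hodgeCorr_siegelPeriodEquiv_one_of_not_mem_hodgeGroupExceptionalLocus (hg : 0 < g) {δ : Fin g → ℕ} (hδ : ∀ i, 0 < δ i) {Z : siegelUpperHalfSpace g} (hZ : Z ∉ hodgeGroupExceptionalLocus g) (f : Fin (g + g) ≃ Fin g ⊕ Fin g) (hf : orientationSign (siegelPeriodEquiv hδ Z.2) f = 1)
    (f' : Fin ((g + g) + (g + g)) ≃ (Fin g ⊕ Fin g) ⊕ (Fin g ⊕ Fin g)) :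
    ∃! T : Finset (CorrRing.hodgeCorr (siegelPeriodEquiv hδ Z.2) f hf f'), IsPrimitiveDecomposition T 1 :=
  existsUnique_isPrimitiveDecomposition_hodgeCorr_one_of_isRiemannForm_of_hodgeGroup_eq_spGroup (ComplexTorusCat.of ⟨Fin g ⊕ Fin g, Fin g → ℂ, siegelPeriodEquiv hδ Z.2⟩) (θ := (⟨siegelForm hδ Z.2, (mem_neronSeveriGroup_iff _).2 (isRiemannForm_siegelForm hδ Z.2).isNSForm⟩ : neronSeveriGroup (siegelPeriodEquiv hδ Z.2))) (isRiemannForm_siegelForm hδ Z.2) (hodgeGroup_eq_spGroup_of_not_mem_type hδ hZ) hg f hf f'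

/-- **OFF `𝒩_Hg`: every decomposition of `h(X_Z)` into simple Hodge motives has exactly `#KunnemannIndex(g)` members.** [cite: Lange2023AbelianVarietiesComplex, §7.3.1 Prop. 7.3.2 (p0336), §7.2.2 Thm. 7.2.4 (p0331) and §7.3.2 (1)–(3) (p0338 L3–L16)] [cite: Lam2001FirstCourse, §22 Prop. (22.1), p. 325] [cite: Kahn2020, §6.7 Thm. 6.20, §6.12.2 Cor. 6.42 and App. A Thm. A.6 (p0135)] [cite: Kunnemann1993] -/
theorem card_eq_card_kunnemannIndex_of_isPrimitiveDecomposition_hodgeCorr_siegelPeriodEquiv_one_of_not_mem_hodgeGroupExceptionalLocus (hg : 0 < g) {δ : Fin g → ℕ} (hδ : ∀ i, 0 < δ i) {Z : siegelUpperHalfSpace g} (hZ : Z ∉ hodgeGroupExceptionalLocus g) (f : Fin (g + g) ≃ Fin g ⊕ Fin g) (hf : orientationSign (siegelPeriodEquiv hδ Z.2) f = 1)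
    (f' : Fin ((g + g) + (g + g)) ≃ (Fin g ⊕ Fin g) ⊕ (Fin g ⊕ Fin g))
    {T : Finset (CorrRing.hodgeCorr (siegelPeriodEquiv hδ Z.2) f hf f')} (hT : IsPrimitiveDecomposition T 1) : T.card = Fintype.card (KunnemannIndex g) :=
  card_eq_card_kunnemannIndex_of_isPrimitiveDecomposition_hodgeCorr_one_of_isRiemannForm_of_hodgeGroup_eq_spGroup (ComplexTorusCat.of ⟨Fin g ⊕ Fin g, Fin g → ℂ, siegelPeriodEquiv hδ Z.2⟩) (θ := (⟨siegelForm hδ Z.2, (mem_neronSeveriGroup_iff _).2 (isRiemannForm_siegelForm hδ Z.2).isNSForm⟩ : neronSeveriGroup (siegelPeriodEquiv hδ Z.2))) (isRiemannForm_siegelForm hδ Z.2) (hodgeGroup_eq_spGroup_of_not_mem_type hδ hZ) hg f hf f' hT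

/-- **OFF `𝒩_Hg`: `hˢ(X_Z)` is the sum of exactly `⌊min(s, 2g−s)/2⌋ + 1` simple Hodge motives in every primitive decomposition of `h(X_Z)`** (`s ≤ 2g`).
[cite: Kahn2020, §6.12.2 Cor. 6.42 and Def. 6.43 (p0129)] [cite: Lange2023AbelianVarietiesComplex, §7.3.1 Prop. 7.3.2 (p0336), §7.2.2 Thm. 7.2.4 (p0331) and §7.3.2 (1)–(3) (p0338 L3–L16)] [cite: Lam2001FirstCourse, §22 Prop. (22.1), p. 325] [cite: Kahn2020, §6.7 Thm. 6.20, §6.12.2 Cor. 6.42 and App. A Thm. A.6 (p0135)] [cite: Kunnemann1993] -/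
theorem card_filter_hodgeKunnethIdem_mul_eq_of_isPrimitiveDecomposition_hodgeCorr_siegelPeriodEquiv_one_of_not_mem_hodgeGroupExceptionalLocus (hg : 0 < g) {δ : Fin g → ℕ} (hδ : ∀ i, 0 < δ i) {Z : siegelUpperHalfSpace g} (hZ : Z ∉ hodgeGroupExceptionalLocus g) (f : Fin (g + g) ≃ Fin g ⊕ Fin g) (hf : orientationSign (siegelPeriodEquiv hδ Z.2) f = 1)
    (f' : Fin ((g + g) + (g + g)) ≃ (Fin g ⊕ Fin g) ⊕ (Fin g ⊕ Fin g))
    {T : Finset (CorrRing.hodgeCorr (siegelPeriodEquiv hδ Z.2) f hf f')} (hT : IsPrimitiveDecomposition T 1) {s : ℕ} (hs : s ≤ g + g) :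
    (T.filter fun x ↦ CorrRing.hodgeKunnethIdem (siegelPeriodEquiv hδ Z.2) f hf f' s * x = x).card = min s (g + g - s) / 2 + 1 :=
  card_filter_hodgeKunnethIdem_mul_eq_of_isPrimitiveDecomposition_hodgeCorr_one_of_isRiemannForm_of_hodgeGroup_eq_spGroup (ComplexTorusCat.of ⟨Fin g ⊕ Fin g, Fin g → ℂ, siegelPeriodEquiv hδ Z.2⟩) (θ := (⟨siegelForm hδ Z.2, (mem_neronSeveriGroup_iff _).2 (isRiemannForm_siegelForm hδ Z.2).isNSForm⟩ : neronSeveriGroup (siegelPeriodEquiv hδ Z.2))) (isRiemannForm_siegelForm hδ Z.2) (hodgeGroup_eq_spGroup_of_not_mem_type hδ hZ) hg f hf f' hT hs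

/-- **OFF `𝒩_Hg`: EVERY DECOMPOSITION OF THE `ℚ`-HODGE STRUCTURE `Hˢ(X_Z, ℚ)` INTO INDECOMPOSABLE SUB-HODGE STRUCTURES HAS EXACTLY `⌊min(s, 2g−s)/2⌋ + 1` MEMBERS** (`s ≤ 2g`; ✔ g46-#3 §4 + Prop. 7.3.2).
[cite: Kahn2020, §3.5.2 Prop. 3.45, §6.7 Thm. 6.20 and §6.12.2 Cor. 6.42] [cite: Lange2023AbelianVarietiesComplex, §7.3.1 Prop. 7.3.2 (p0336), §7.2.2 Thm. 7.2.4 (p0331) and §7.3.2 (1)–(3) (p0338 L3–L16)] [cite: Lam2001FirstCourse, §22 Prop. (22.1), p. 325] [cite: Kahn2020, §6.7 Thm. 6.20, §6.12.2 Cor. 6.42 and App. A Thm. A.6 (p0135)] [cite: Kunnemann1993] -/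
theorem card_eq_of_isPrimitiveDecomposition_endAlg_hodgeStructure_siegelPeriodEquiv_one_of_not_mem_hodgeGroupExceptionalLocus (hg : 0 < g) {δ : Fin g → ℕ} (hδ : ∀ i, 0 < δ i) {Z : siegelUpperHalfSpace g} (hZ : Z ∉ hodgeGroupExceptionalLocus g) {s : Fin (g + g + 1)}
    {T : Finset (hodgeStructure (siegelPeriodEquiv hδ Z.2) (s : ℕ)).endAlg} (hT : IsPrimitiveDecomposition T 1) : T.card = min (s : ℕ) (g + g - s) / 2 + 1 := by
  obtain ⟨f, hf⟩ := exists_orientationSign_eq_one (siegelPeriodEquiv hδ Z.2) (finSumFinEquiv.symm : Fin (g + g) ≃ Fin g ⊕ Fin g)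
  exact card_eq_of_isPrimitiveDecomposition_endAlg_one_of_isRiemannForm_of_hodgeGroup_eq_spGroup (ComplexTorusCat.of ⟨Fin g ⊕ Fin g, Fin g → ℂ, siegelPeriodEquiv hδ Z.2⟩) (θ := (⟨siegelForm hδ Z.2, (mem_neronSeveriGroup_iff _).2 (isRiemannForm_siegelForm hδ Z.2).isNSForm⟩ : neronSeveriGroup (siegelPeriodEquiv hδ Z.2))) (isRiemannForm_siegelForm hδ Z.2) (hodgeGroup_eq_spGroup_of_not_mem_type hδ hZ) hg f hf
    (finSumFinEquiv.symm.trans (f.sumCongr f)) hT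

/-- **OFF `𝒩_Hg`: the decomposition of `h(X_Z)` into simple LEFSCHETZ motives (in Milne's `Dᵍ(X_Z × X_Z)`) is unique as well.** [cite: Milne1999LefschetzClasses, §5 Prop. 5.7, Cor. 5.8, Thm. 5.9] [cite: Lange2023AbelianVarietiesComplex, §7.3.1 Prop. 7.3.2 (p0336), §7.2.2 Thm. 7.2.4 (p0331) and §7.3.2 (1)–(3) (p0338 L3–L16)] [cite: Lam2001FirstCourse, §22 Prop. (22.1), p. 325] [cite: Kahn2020, §6.7 Thm. 6.20, §6.12.2 Cor. 6.42 and App. A Thm. A.6 (p0135)] [cite: Kunnemann1993] -/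
theorem existsUnique_isPrimitiveDecomposition_lefschetzCorr_siegelPeriodEquiv_one_of_not_mem_hodgeGroupExceptionalLocus (hg : 0 < g) {δ : Fin g → ℕ} (hδ : ∀ i, 0 < δ i) {Z : siegelUpperHalfSpace g} (hZ : Z ∉ hodgeGroupExceptionalLocus g) (f : Fin (g + g) ≃ Fin g ⊕ Fin g) (hf : orientationSign (siegelPeriodEquiv hδ Z.2) f = 1)
    (f' : Fin ((g + g) + (g + g)) ≃ (Fin g ⊕ Fin g) ⊕ (Fin g ⊕ Fin g)) :
    ∃! T : Finset (CorrRing.lefschetzCorr (siegelPeriodEquiv hδ Z.2) f hf f' (isRiemannForm_siegelForm hδ Z.2)), IsPrimitiveDecomposition T 1 :=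
  existsUnique_isPrimitiveDecomposition_lefschetzCorr_one_of_isRiemannForm_of_endAlgRat_eq_bot (ComplexTorusCat.of ⟨Fin g ⊕ Fin g, Fin g → ℂ, siegelPeriodEquiv hδ Z.2⟩) (θ := (⟨siegelForm hδ Z.2, (mem_neronSeveriGroup_iff _).2 (isRiemannForm_siegelForm hδ Z.2).isNSForm⟩ : neronSeveriGroup (siegelPeriodEquiv hδ Z.2))) (isRiemannForm_siegelForm hδ Z.2)
    ((isRiemannForm_siegelForm hδ Z.2).endAlgRat_eq_bot_of_hodgeGroup_eq_spGroup (hodgeGroup_eq_spGroup_of_not_mem_type hδ hZ)) hg f hf f'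

/-! ## §3 Density in the Siegel upper half space (Prop. 7.3.2: the complement of `𝒩_Hg` is dense) -/

/-- **THE `Z ∈ 𝔥_g` WITH `End_Hdg(Hˢ(X_Z, ℚ)) ≅ ℚ^{⌊s/2⌋+1}` FOR ALL `s ≤ g` ARE DENSE** (`g ≥ 1`). [cite: Lange2023AbelianVarietiesComplex, §7.3.1 Prop. 7.3.2 (p0336 L7–L21)] [cite: Lange2023AbelianVarietiesComplex, §7.3.1 Prop. 7.3.2 (p0336), §7.2.2 Thm. 7.2.4 (p0331) and §7.3.2 (1)–(3) (p0338 L3–L16)] [cite: Lam2001FirstCourse, §22 Prop. (22.1), p. 325] [cite: Kahn2020, §6.7 Thm. 6.20, §6.12.2 Cor. 6.42 and App. A Thm. A.6 (p0135)] [cite: Kunnemann1993] -/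
theorem dense_setOf_forall_nonempty_endAlg_hodgeStructure_siegelPeriodEquiv_algEquiv_pi (hg : 0 < g) {δ : Fin g → ℕ} (hδ : ∀ i, 0 < δ i) :
    Dense {Z : siegelUpperHalfSpace g | ∀ s ≤ g, Nonempty ((hodgeStructure (siegelPeriodEquiv hδ Z.2) s).endAlg ≃ₐ[ℚ] (Fin (s / 2 + 1) → ℚ))} :=
  dense_compl_hodgeGroupExceptionalLocus.mono fun _ hZ _ hs ↦ nonempty_endAlg_hodgeStructure_siegelPeriodEquiv_algEquiv_pi_of_not_mem_hodgeGroupExceptionalLocus hg hδ hZ hs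

/-- **THE `Z ∈ 𝔥_g` ALL OF WHOSE LEFSCHETZ PIECES `Lʳ H^m(X_Z, ℚ)_prim` (`2r + m ≤ g`) HAVE `End_Hdg = ℚ` ARE DENSE** (`g ≥ 1`). [cite: Lange2023AbelianVarietiesComplex, §7.3.1 Prop. 7.3.2 (p0336 L7–L21)] [cite: Lange2023AbelianVarietiesComplex, §7.3.1 Prop. 7.3.2 (p0336) and §7.3.2 (3) (p0338 L12–L16)] [cite: VoisinHodgeI2002, §7.1.2 and §7.3.1 Cor. 7.24] [cite: Lam2001FirstCourse, §21 (21.6)–(21.7)] [cite: Kunnemann1993] -/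
theorem dense_setOf_forall_endAlg_lefschetzSummandSubHodgeStructure_siegelPeriodEquiv_eq_bot (hg : 0 < g) {δ : Fin g → ℕ} (hδ : ∀ i, 0 < δ i) :
    Dense {Z : siegelUpperHalfSpace g | ∀ (r m k : ℕ) (hm : 2 * r + m = k), k ≤ g → ((isRiemannForm_siegelForm hδ Z.2).isNSForm.lefschetzSummandSubHodgeStructure (siegelPeriodEquiv hδ Z.2) r hm).toHodgeStructure.endAlg = ⊥} :=
  dense_compl_hodgeGroupExceptionalLocus.mono fun _ hZ _ _ _ hm hk ↦ endAlg_lefschetzSummandSubHodgeStructure_siegelPeriodEquiv_eq_bot_of_not_mem_hodgeGroupExceptionalLocus hg hδ hZ hm hk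

/-- **THE `Z ∈ 𝔥_g` WITH `Bᵍ(X_Z × X_Z) ≅ ℚ^{KunnemannIndex(g)}` (in every positively oriented ring frame) ARE DENSE** (`g ≥ 1`). [cite: Lange2023AbelianVarietiesComplex, §7.3.1 Prop. 7.3.2 (p0336 L7–L21)] [cite: Lange2023AbelianVarietiesComplex, §7.3.1 Prop. 7.3.2 (p0336), §7.2.2 Thm. 7.2.4 (p0331) and §7.3.2 (1)–(3) (p0338 L3–L16)] [cite: Lam2001FirstCourse, §22 Prop. (22.1), p. 325] [cite: Kahn2020, §6.7 Thm. 6.20, §6.12.2 Cor. 6.42 and App. A Thm. A.6 (p0135)] [cite: Kunnemann1993] -/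
theorem dense_setOf_forall_nonempty_hodgeCorr_siegelPeriodEquiv_algEquiv_pi (hg : 0 < g) {δ : Fin g → ℕ} (hδ : ∀ i, 0 < δ i) :
    Dense {Z : siegelUpperHalfSpace g | ∀ (f : Fin (g + g) ≃ Fin g ⊕ Fin g) (hf : orientationSign (siegelPeriodEquiv hδ Z.2) f = 1) (f' : Fin ((g + g) + (g + g)) ≃ (Fin g ⊕ Fin g) ⊕ (Fin g ⊕ Fin g)),
      Nonempty (CorrRing.hodgeCorr (siegelPeriodEquiv hδ Z.2) f hf f' ≃ₐ[ℚ] (KunnemannIndex g → ℚ))} :=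
  dense_compl_hodgeGroupExceptionalLocus.mono fun _ hZ f hf f' ↦ nonempty_hodgeCorr_siegelPeriodEquiv_algEquiv_pi_of_not_mem_hodgeGroupExceptionalLocus hg hδ hZ f hf f'

/-- **THE `Z ∈ 𝔥_g` WHOSE HODGE MOTIVE `h(X_Z)` HAS A UNIQUE DECOMPOSITION INTO SIMPLE MOTIVES WITH `#KunnemannIndex(g)` MEMBERS (in every positively oriented ring frame) ARE DENSE** (`g ≥ 1`).
[cite: Lange2023AbelianVarietiesComplex, §7.3.1 Prop. 7.3.2 (p0336 L7–L21)] [cite: Lange2023AbelianVarietiesComplex, §7.3.1 Prop. 7.3.2 (p0336), §7.2.2 Thm. 7.2.4 (p0331) and §7.3.2 (1)–(3) (p0338 L3–L16)] [cite: Lam2001FirstCourse, §22 Prop. (22.1), p. 325] [cite: Kahn2020, §6.7 Thm. 6.20, §6.12.2 Cor. 6.42 and App. A Thm. A.6 (p0135)] [cite: Kunnemann1993] -/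
theorem dense_setOf_forall_existsUnique_isPrimitiveDecomposition_hodgeCorr_siegelPeriodEquiv_one (hg : 0 < g) {δ : Fin g → ℕ} (hδ : ∀ i, 0 < δ i) :
    Dense {Z : siegelUpperHalfSpace g | ∀ (f : Fin (g + g) ≃ Fin g ⊕ Fin g) (hf : orientationSign (siegelPeriodEquiv hδ Z.2) f = 1) (f' : Fin ((g + g) + (g + g)) ≃ (Fin g ⊕ Fin g) ⊕ (Fin g ⊕ Fin g)),
      (∃! T : Finset (CorrRing.hodgeCorr (siegelPeriodEquiv hδ Z.2) f hf f'), IsPrimitiveDecomposition T 1) ∧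
        ∀ T : Finset (CorrRing.hodgeCorr (siegelPeriodEquiv hδ Z.2) f hf f'), IsPrimitiveDecomposition T 1 → T.card = Fintype.card (KunnemannIndex g)} :=
  dense_compl_hodgeGroupExceptionalLocus.mono fun _ hZ f hf f' ↦
    ⟨existsUnique_isPrimitiveDecomposition_hodgeCorr_siegelPeriodEquiv_one_of_not_mem_hodgeGroupExceptionalLocus hg hδ hZ f hf f',
      fun _ hT ↦ card_eq_card_kunnemannIndex_of_isPrimitiveDecomposition_hodgeCorr_siegelPeriodEquiv_one_of_not_mem_hodgeGroupExceptionalLocus hg hδ hZ f hf f' hT⟩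

/-! ## §4 Every weight `s ≤ 2g` (✔ g46-#5 above the middle): `End_Hdg(Hˢ(X^δ_Z, ℚ)) ≅ ℚ^{⌊min(s, 2g−s)/2⌋+1}`, the UNIQUE decomposition of `Hˢ(X^δ_Z, ℚ)` into indecomposable
sub-Hodge structures (= the Lefschetz decomposition), the number of sub-Hodge structures (✔ g45-#9), density -/

/-- **OFF `𝒩_Hg`: `End_Hdg(Hˢ(X^δ_Z, ℚ)) ≅ ℚ × ⋯ × ℚ` (`⌊min(s, 2g−s)/2⌋ + 1` factors) AS `ℚ`-ALGEBRAS, FOR EVERY `s ≤ 2g`** (✔ g46-#5 §4 + Prop. 7.3.2). [cite: Lange2023AbelianVarietiesComplex, §7.3.1 Prop. 7.3.2 (p0336), §3.6 Thm. 3.6.1, §7.2.2 Thm. 7.2.4 (p0331) and §7.3.2 (1)–(3) (p0338 L3–L16)] [cite: Lam2001FirstCourse, §22 Prop. (22.1), p. 325] [cite: Kahn2020, §3.5.2 Prop. 3.45, §6.7 Thm. 6.20 and §6.12.2 Cor. 6.42] [cite: VoisinHodgeI2002, §7.1.2 and §7.3.1 Cor. 7.24] [cite: Kunnemann1993]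
[cite: GoodmanWallachGTM255, §5.5.1 Cor. 5.5.9 (5.54)] -/
theorem nonempty_endAlg_hodgeStructure_siegelPeriodEquiv_algEquiv_pi_of_le_two_mul_of_not_mem_hodgeGroupExceptionalLocus (hg : 0 < g) {δ : Fin g → ℕ} (hδ : ∀ i, 0 < δ i) {Z : siegelUpperHalfSpace g} (hZ : Z ∉ hodgeGroupExceptionalLocus g) {s : ℕ} (hs : s ≤ 2 * g) :
    Nonempty ((hodgeStructure (siegelPeriodEquiv hδ Z.2) s).endAlg ≃ₐ[ℚ] (Fin (min s (2 * g - s) / 2 + 1) → ℚ)) := by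
  have h := nonempty_endAlg_hodgeStructure_algEquiv_pi_of_le_two_mul_of_isRiemannForm_of_hodgeGroup_eq_spGroup (ComplexTorusCat.of ⟨Fin g ⊕ Fin g, Fin g → ℂ, siegelPeriodEquiv hδ Z.2⟩) (θ := (⟨siegelForm hδ Z.2, (mem_neronSeveriGroup_iff _).2 (isRiemannForm_siegelForm hδ Z.2).isNSForm⟩ : neronSeveriGroup (siegelPeriodEquiv hδ Z.2))) (isRiemannForm_siegelForm hδ Z.2) (hodgeGroup_eq_spGroup_of_not_mem_type hδ hZ)
    (by rw [finrank_prin₆₆]; exact hg) (s := s) (by rw [finrank_prin₆₆]; exact hs)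
  rwa [finrank_prin₆₆] at h

/-- **OFF `𝒩_Hg`: `End_Hdg(Hˢ(X^δ_Z, ℚ))` has exactly `⌊min(s, 2g−s)/2⌋ + 1` blocks** (`s ≤ 2g`). [cite: Lange2023AbelianVarietiesComplex, §7.3.1 Prop. 7.3.2 (p0336), §3.6 Thm. 3.6.1, §7.2.2 Thm. 7.2.4 (p0331) and §7.3.2 (1)–(3) (p0338 L3–L16)] [cite: Lam2001FirstCourse, §22 Prop. (22.1), p. 325] [cite: Kahn2020, §3.5.2 Prop. 3.45, §6.7 Thm. 6.20 and §6.12.2 Cor. 6.42] [cite: VoisinHodgeI2002, §7.1.2 and §7.3.1 Cor. 7.24] [cite: Kunnemann1993] -/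
theorem ncard_setOf_isCentrallyPrimitive_endAlg_hodgeStructure_siegelPeriodEquiv_of_le_two_mul_of_not_mem_hodgeGroupExceptionalLocus (hg : 0 < g) {δ : Fin g → ℕ} (hδ : ∀ i, 0 < δ i) {Z : siegelUpperHalfSpace g} (hZ : Z ∉ hodgeGroupExceptionalLocus g) {s : ℕ} (hs : s ≤ 2 * g) :
    {u : (hodgeStructure (siegelPeriodEquiv hδ Z.2) s).endAlg | IsCentrallyPrimitive u}.ncard = min s (2 * g - s) / 2 + 1 := by
  have h := ncard_setOf_isCentrallyPrimitive_endAlg_hodgeStructure_of_le_two_mul_of_isRiemannForm_of_hodgeGroup_eq_spGroup (ComplexTorusCat.of ⟨Fin g ⊕ Fin g, Fin g → ℂ, siegelPeriodEquiv hδ Z.2⟩) (θ := (⟨siegelForm hδ Z.2, (mem_neronSeveriGroup_iff _).2 (isRiemannForm_siegelForm hδ Z.2).isNSForm⟩ : neronSeveriGroup (siegelPeriodEquiv hδ Z.2))) (isRiemannForm_siegelForm hδ Z.2) (hodgeGroup_eq_spGroup_of_not_mem_type hδ hZ)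
    (by rw [finrank_prin₆₆]; exact hg) (s := s) (by rw [finrank_prin₆₆]; exact hs)
  rwa [finrank_prin₆₆] at h

/-- **OFF `𝒩_Hg`: `Hˢ(X^δ_Z, ℚ)` has exactly `⌊min(s, 2g−s)/2⌋ + 1` indecomposable direct-summand sub-Hodge structures cut out by primitive idempotent Hodge endomorphisms** (`s ≤ 2g`). [cite: Lange2023AbelianVarietiesComplex, §7.3.1 Prop. 7.3.2 (p0336), §3.6 Thm. 3.6.1, §7.2.2 Thm. 7.2.4 (p0331) and §7.3.2 (1)–(3) (p0338 L3–L16)] [cite: Lam2001FirstCourse, §22 Prop. (22.1), p. 325] [cite: Kahn2020, §3.5.2 Prop. 3.45, §6.7 Thm. 6.20 and §6.12.2 Cor. 6.42] [cite: VoisinHodgeI2002, §7.1.2 and §7.3.1 Cor. 7.24] [cite: Kunnemann1993] -/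
theorem ncard_setOf_isPrimitiveIdempotent_endAlg_hodgeStructure_siegelPeriodEquiv_of_le_two_mul_of_not_mem_hodgeGroupExceptionalLocus (hg : 0 < g) {δ : Fin g → ℕ} (hδ : ∀ i, 0 < δ i) {Z : siegelUpperHalfSpace g} (hZ : Z ∉ hodgeGroupExceptionalLocus g) {s : ℕ} (hs : s ≤ 2 * g) :
    {u : (hodgeStructure (siegelPeriodEquiv hδ Z.2) s).endAlg | IsPrimitiveIdempotent u}.ncard = min s (2 * g - s) / 2 + 1 := by
  have h := ncard_setOf_isPrimitiveIdempotent_endAlg_hodgeStructure_of_le_two_mul_of_isRiemannForm_of_hodgeGroup_eq_spGroup (ComplexTorusCat.of ⟨Fin g ⊕ Fin g, Fin g → ℂ, siegelPeriodEquiv hδ Z.2⟩) (θ := (⟨siegelForm hδ Z.2, (mem_neronSeveriGroup_iff _).2 (isRiemannForm_siegelForm hδ Z.2).isNSForm⟩ : neronSeveriGroup (siegelPeriodEquiv hδ Z.2))) (isRiemannForm_siegelForm hδ Z.2) (hodgeGroup_eq_spGroup_of_not_mem_type hδ hZ)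
    (by rw [finrank_prin₆₆]; exact hg) (s := s) (by rw [finrank_prin₆₆]; exact hs)
  rwa [finrank_prin₆₆] at h

/-- **OFF `𝒩_Hg`: `End_Hdg(Hˢ(X^δ_Z, ℚ))` has exactly `2^(⌊min(s, 2g−s)/2⌋ + 1)` idempotents** (`s ≤ 2g`) — as many as `Hˢ(X^δ_Z, ℚ)` has sub-Hodge structures (next theorem): every sub-Hodge structure
is a direct summand in exactly one way. [cite: Lam2001FirstCourse, §22 Prop. (22.1) (1) and (3), p. 325] [cite: Lange2023AbelianVarietiesComplex, §7.3.1 Prop. 7.3.2 (p0336), §3.6 Thm. 3.6.1, §7.2.2 Thm. 7.2.4 (p0331) and §7.3.2 (1)–(3) (p0338 L3–L16)] [cite: Lam2001FirstCourse, §22 Prop. (22.1), p. 325] [cite: Kahn2020, §3.5.2 Prop. 3.45, §6.7 Thm. 6.20 and §6.12.2 Cor. 6.42] [cite: VoisinHodgeI2002, §7.1.2 and §7.3.1 Cor. 7.24] [cite: Kunnemann1993] -/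
theorem ncard_setOf_isIdempotentElem_endAlg_hodgeStructure_siegelPeriodEquiv_of_le_two_mul_of_not_mem_hodgeGroupExceptionalLocus (hg : 0 < g) {δ : Fin g → ℕ} (hδ : ∀ i, 0 < δ i) {Z : siegelUpperHalfSpace g} (hZ : Z ∉ hodgeGroupExceptionalLocus g) {s : ℕ} (hs : s ≤ 2 * g) :
    {u : (hodgeStructure (siegelPeriodEquiv hδ Z.2) s).endAlg | IsIdempotentElem u}.ncard = 2 ^ (min s (2 * g - s) / 2 + 1) := by
  have h := ncard_setOf_isIdempotentElem_endAlg_hodgeStructure_of_le_two_mul_of_isRiemannForm_of_hodgeGroup_eq_spGroup (ComplexTorusCat.of ⟨Fin g ⊕ Fin g, Fin g → ℂ, siegelPeriodEquiv hδ Z.2⟩) (θ := (⟨siegelForm hδ Z.2, (mem_neronSeveriGroup_iff _).2 (isRiemannForm_siegelForm hδ Z.2).isNSForm⟩ : neronSeveriGroup (siegelPeriodEquiv hδ Z.2))) (isRiemannForm_siegelForm hδ Z.2) (hodgeGroup_eq_spGroup_of_not_mem_type hδ hZ)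
    (by rw [finrank_prin₆₆]; exact hg) (s := s) (by rw [finrank_prin₆₆]; exact hs)
  rwa [finrank_prin₆₆] at h

/-- **OFF `𝒩_Hg`: `Hˢ(X^δ_Z, ℚ)` HAS EXACTLY `2^(⌊min(s, 2g−s)/2⌋ + 1)` SUB-`ℚ`-HODGE STRUCTURES** (`s ≤ 2g`; ✔ g45-#9 + Prop. 7.3.2).
[cite: Lange2023AbelianVarietiesComplex, §7.3.2 (1)–(3) (p0338), §7.3.1 Prop. 7.3.2] [cite: CarlsonMullerStachPeters2017, §15.2 Lemma 15.2.7] [cite: GoodmanWallachGTM255, §5.5.2 Cor. 5.5.16] -/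
theorem natCard_subHodgeStructure_hodgeStructure_siegelPeriodEquiv_of_not_mem_hodgeGroupExceptionalLocus {Z : siegelUpperHalfSpace g} {δ : Fin g → ℕ} (hδ : ∀ i, 0 < δ i)
    (hZ : Z ∉ hodgeGroupExceptionalLocus g) {s : ℕ} (hs : s ≤ 2 * g) :
    Nat.card (SubHodgeStructure (hodgeStructure (siegelPeriodEquiv hδ Z.2) s)) = 2 ^ (min s (2 * g - s) / 2 + 1) := by
  have h := natCard_subHodgeStructure_hodgeStructure_of_hodgeGroup_eq_spGroup (ComplexTorusCat.of ⟨Fin g ⊕ Fin g, Fin g → ℂ, siegelPeriodEquiv hδ Z.2⟩) (θ := (⟨siegelForm hδ Z.2, (mem_neronSeveriGroup_iff _).2 (isRiemannForm_siegelForm hδ Z.2).isNSForm⟩ : neronSeveriGroup (siegelPeriodEquiv hδ Z.2))) (isRiemannForm_siegelForm hδ Z.2) (hodgeGroup_eq_spGroup_of_not_mem_type hδ hZ)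
    (k := s) (by rw [finrank_prin₆₆]; exact hs)
  rwa [finrank_prin₆₆] at h

/-- **OFF `𝒩_Hg`: THE DECOMPOSITION OF THE `ℚ`-HODGE STRUCTURE `Hˢ(X^δ_Z, ℚ)` INTO INDECOMPOSABLE SUB-HODGE STRUCTURES IS UNIQUE, FOR EVERY `s ≤ 2g`** (it is the rational Lefschetz
decomposition of the polarization; ✔ g46-#5 §4 + Prop. 7.3.2). [cite: Lam2001FirstCourse, §22 Prop. (22.1) (3), p. 325] [cite: Lange2023AbelianVarietiesComplex, §7.3.1 Prop. 7.3.2 (p0336), §3.6 Thm. 3.6.1, §7.2.2 Thm. 7.2.4 (p0331) and §7.3.2 (1)–(3) (p0338 L3–L16)] [cite: Lam2001FirstCourse, §22 Prop. (22.1), p. 325] [cite: Kahn2020, §3.5.2 Prop. 3.45, §6.7 Thm. 6.20 and §6.12.2 Cor. 6.42] [cite: VoisinHodgeI2002, §7.1.2 and §7.3.1 Cor. 7.24] [cite: Kunnemann1993] -/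
theorem existsUnique_isPrimitiveDecomposition_endAlg_hodgeStructure_siegelPeriodEquiv_one_of_le_two_mul_of_not_mem_hodgeGroupExceptionalLocus (hg : 0 < g) {δ : Fin g → ℕ} (hδ : ∀ i, 0 < δ i) {Z : siegelUpperHalfSpace g} (hZ : Z ∉ hodgeGroupExceptionalLocus g) {s : ℕ} (hs : s ≤ 2 * g) :
    ∃! T : Finset (hodgeStructure (siegelPeriodEquiv hδ Z.2) s).endAlg, IsPrimitiveDecomposition T 1 :=
  existsUnique_isPrimitiveDecomposition_endAlg_hodgeStructure_one_of_le_two_mul_of_isRiemannForm_of_hodgeGroup_eq_spGroup (ComplexTorusCat.of ⟨Fin g ⊕ Fin g, Fin g → ℂ, siegelPeriodEquiv hδ Z.2⟩) (θ := (⟨siegelForm hδ Z.2, (mem_neronSeveriGroup_iff _).2 (isRiemannForm_siegelForm hδ Z.2).isNSForm⟩ : neronSeveriGroup (siegelPeriodEquiv hδ Z.2))) (isRiemannForm_siegelForm hδ Z.2) (hodgeGroup_eq_spGroup_of_not_mem_type hδ hZ)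
    (by rw [finrank_prin₆₆]; exact hg) (by rw [finrank_prin₆₆]; exact hs)

/-- **OFF `𝒩_Hg`: THE MEMBERS OF ANY DECOMPOSITION OF `Hˢ(X^δ_Z, ℚ)` (`s ≤ 2g`) INTO INDECOMPOSABLE SUB-`ℚ`-HODGE STRUCTURES ARE THE LEFSCHETZ SUMMANDS `Lʳ H^{s−2r}(X^δ_Z, ℚ)_prim`
of the polarization** (✔ g46-#5 §4 + Prop. 7.3.2). [cite: Lange2023AbelianVarietiesComplex, §7.3.1 Prop. 7.3.2 (p0336), §3.6 Thm. 3.6.1, §7.2.2 Thm. 7.2.4 (p0331) and §7.3.2 (1)–(3) (p0338 L3–L16)] [cite: Lam2001FirstCourse, §22 Prop. (22.1), p. 325] [cite: Kahn2020, §3.5.2 Prop. 3.45, §6.7 Thm. 6.20 and §6.12.2 Cor. 6.42] [cite: VoisinHodgeI2002, §7.1.2 and §7.3.1 Cor. 7.24] [cite: Kunnemann1993] -/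
theorem exists_range_toHom_eq_lefschetzSummandSubHodgeStructure_siegelPeriodEquiv_of_mem_isPrimitiveDecomposition_endAlg_of_not_mem_hodgeGroupExceptionalLocus (hg : 0 < g) {δ : Fin g → ℕ} (hδ : ∀ i, 0 < δ i) {Z : siegelUpperHalfSpace g} (hZ : Z ∉ hodgeGroupExceptionalLocus g) {s : ℕ}
    (hs : s ≤ 2 * g) {T : Finset (hodgeStructure (siegelPeriodEquiv hδ Z.2) s).endAlg} (hT : IsPrimitiveDecomposition T 1) {u : (hodgeStructure (siegelPeriodEquiv hδ Z.2) s).endAlg} (hu : u ∈ T) :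
    ∃ (r : ℕ) (hr : 2 * r ≤ s), (endAlg.toHom u).range = ((isRiemannForm_siegelForm hδ Z.2).isNSForm.lefschetzSummandSubHodgeStructure (siegelPeriodEquiv hδ Z.2) r (Nat.add_sub_cancel' hr)) :=
  exists_range_toHom_eq_lefschetzSummandSubHodgeStructure_of_mem_isPrimitiveDecomposition_endAlg_of_le_two_mul_of_isRiemannForm_of_hodgeGroup_eq_spGroup (ComplexTorusCat.of ⟨Fin g ⊕ Fin g, Fin g → ℂ, siegelPeriodEquiv hδ Z.2⟩) (θ := (⟨siegelForm hδ Z.2, (mem_neronSeveriGroup_iff _).2 (isRiemannForm_siegelForm hδ Z.2).isNSForm⟩ : neronSeveriGroup (siegelPeriodEquiv hδ Z.2))) (isRiemannForm_siegelForm hδ Z.2) (hodgeGroup_eq_spGroup_of_not_mem_type hδ hZ)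
    (by rw [finrank_prin₆₆]; exact hg)
    (by rw [finrank_prin₆₆]; exact hs) hT hu

/-- **OFF `𝒩_Hg`: A RATIONAL SUBSPACE `W ⊆ Hᵏ(X^δ_Z, ℚ)` (`k ≤ 2g`) IS A SUB-HODGE STRUCTURE IFF IT IS A SUM OF LEFSCHETZ PIECES `⨆_{r ∈ S} Lʳ P^{k−2r}(X^δ_Z, ℚ)`, `S ⊆ lefschetzRange g k`**
(✔ g45-#9 `isSubHodge_iff_exists_subset_lefschetzRange_of_hodgeGroup_eq_spGroup` + Prop. 7.3.2). [cite: Lange2023AbelianVarietiesComplex, §7.3.2 (1)–(3) (p0338), §7.3.1 Prop. 7.3.2, §7.2.2 Thm. 7.2.4]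
[cite: CarlsonMullerStachPeters2017, §15.2 Lemma 15.2.7] [cite: GoodmanWallachGTM255, §5.5.2 Cor. 5.5.16] -/
theorem isSubHodge_iff_exists_subset_lefschetzRange_siegelPeriodEquiv_of_not_mem_hodgeGroupExceptionalLocus {δ : Fin g → ℕ} (hδ : ∀ i, 0 < δ i) {Z : siegelUpperHalfSpace g} (hZ : Z ∉ hodgeGroupExceptionalLocus g) {k : ℕ} (hk : k ≤ 2 * g)
    {W : Submodule ℚ ((Fin g → ℂ) [⋀^Fin k]→L[ℝ] ℂ)} (hWQ : W ≤ rationalForms (siegelPeriodEquiv hδ Z.2) k) :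
    IsSubHodge W ↔ ∃ S : Finset ℕ, S ⊆ lefschetzRange g k ∧ W = ⨆ r ∈ S, ((lefschetzSummandForms (siegelForm hδ Z.2) k r).restrictScalars ℚ ⊓ rationalForms (siegelPeriodEquiv hδ Z.2) k : Submodule ℚ _) := by
  have h := isSubHodge_iff_exists_subset_lefschetzRange_of_hodgeGroup_eq_spGroup (siegelPeriodEquiv hδ Z.2) (isRiemannForm_siegelForm hδ Z.2) (hodgeGroup_eq_spGroup_of_not_mem_type hδ hZ) (k := k) (by rw [Module.finrank_fin_fun]; exact hk) hWQ
  rwa [Module.finrank_fin_fun] at h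

/-- **THE `Z ∈ 𝔥_g` FOR WHICH THE SUB-HODGE STRUCTURES OF EVERY `Hᵏ(X^δ_Z, ℚ)` (`k ≤ 2g`) ARE EXACTLY THE SUMS OF LEFSCHETZ PIECES ARE DENSE.** [cite: Lange2023AbelianVarietiesComplex, §7.3.1 Prop. 7.3.2 (p0336 L7–L21) and §7.3.2 (1)–(3) (p0338)]
[cite: CarlsonMullerStachPeters2017, §15.2 Lemma 15.2.7] -/
theorem dense_setOf_forall_isSubHodge_iff_exists_subset_lefschetzRange_siegelPeriodEquiv {δ : Fin g → ℕ} (hδ : ∀ i, 0 < δ i) :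
    Dense {Z : siegelUpperHalfSpace g | ∀ k ≤ 2 * g, ∀ W : Submodule ℚ ((Fin g → ℂ) [⋀^Fin k]→L[ℝ] ℂ), W ≤ rationalForms (siegelPeriodEquiv hδ Z.2) k →
      (IsSubHodge W ↔ ∃ S : Finset ℕ, S ⊆ lefschetzRange g k ∧ W = ⨆ r ∈ S, ((lefschetzSummandForms (siegelForm hδ Z.2) k r).restrictScalars ℚ ⊓ rationalForms (siegelPeriodEquiv hδ Z.2) k : Submodule ℚ _))} :=
  dense_compl_hodgeGroupExceptionalLocus.mono fun _ hZ _ hk _ hWQ ↦ isSubHodge_iff_exists_subset_lefschetzRange_siegelPeriodEquiv_of_not_mem_hodgeGroupExceptionalLocus hδ hZ hk hWQ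

/-- **THE `Z ∈ 𝔥_g` WITH `End_Hdg(Hˢ(X^δ_Z, ℚ)) ≅ ℚ^{⌊min(s, 2g−s)/2⌋+1}` FOR ALL `s ≤ 2g` ARE DENSE** (`g ≥ 1`). [cite: Lange2023AbelianVarietiesComplex, §7.3.1 Prop. 7.3.2 (p0336 L7–L21)] [cite: Lange2023AbelianVarietiesComplex, §7.3.1 Prop. 7.3.2 (p0336), §3.6 Thm. 3.6.1, §7.2.2 Thm. 7.2.4 (p0331) and §7.3.2 (1)–(3) (p0338 L3–L16)] [cite: Lam2001FirstCourse, §22 Prop. (22.1), p. 325] [cite: Kahn2020, §3.5.2 Prop. 3.45, §6.7 Thm. 6.20 and §6.12.2 Cor. 6.42] [cite: VoisinHodgeI2002, §7.1.2 and §7.3.1 Cor. 7.24] [cite: Kunnemann1993] -/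
theorem dense_setOf_forall_nonempty_endAlg_hodgeStructure_siegelPeriodEquiv_algEquiv_pi_of_le_two_mul (hg : 0 < g) {δ : Fin g → ℕ} (hδ : ∀ i, 0 < δ i) :
    Dense {Z : siegelUpperHalfSpace g | ∀ s ≤ 2 * g, Nonempty ((hodgeStructure (siegelPeriodEquiv hδ Z.2) s).endAlg ≃ₐ[ℚ] (Fin (min s (2 * g - s) / 2 + 1) → ℚ))} :=
  dense_compl_hodgeGroupExceptionalLocus.mono fun _ hZ _ hs ↦ nonempty_endAlg_hodgeStructure_siegelPeriodEquiv_algEquiv_pi_of_le_two_mul_of_not_mem_hodgeGroupExceptionalLocus hg hδ hZ hs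

/-- **THE `Z ∈ 𝔥_g` FOR WHICH EVERY `Hˢ(X^δ_Z, ℚ)` (`s ≤ 2g`) HAS A UNIQUE DECOMPOSITION INTO INDECOMPOSABLE SUB-HODGE STRUCTURES, ALL OF WHOSE MEMBERS ARE LEFSCHETZ SUMMANDS, ARE DENSE** (`g ≥ 1`).
[cite: Lange2023AbelianVarietiesComplex, §7.3.1 Prop. 7.3.2 (p0336 L7–L21)] [cite: Lange2023AbelianVarietiesComplex, §7.3.1 Prop. 7.3.2 (p0336), §3.6 Thm. 3.6.1, §7.2.2 Thm. 7.2.4 (p0331) and §7.3.2 (1)–(3) (p0338 L3–L16)] [cite: Lam2001FirstCourse, §22 Prop. (22.1), p. 325] [cite: Kahn2020, §3.5.2 Prop. 3.45, §6.7 Thm. 6.20 and §6.12.2 Cor. 6.42] [cite: VoisinHodgeI2002, §7.1.2 and §7.3.1 Cor. 7.24] [cite: Kunnemann1993] -/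
theorem dense_setOf_forall_existsUnique_isPrimitiveDecomposition_endAlg_hodgeStructure_siegelPeriodEquiv_one (hg : 0 < g) {δ : Fin g → ℕ} (hδ : ∀ i, 0 < δ i) :
    Dense {Z : siegelUpperHalfSpace g | ∀ s ≤ 2 * g, (∃! T : Finset (hodgeStructure (siegelPeriodEquiv hδ Z.2) s).endAlg, IsPrimitiveDecomposition T 1) ∧
      ∀ (T : Finset (hodgeStructure (siegelPeriodEquiv hδ Z.2) s).endAlg), IsPrimitiveDecomposition T 1 → ∀ u ∈ T,
        ∃ (r : ℕ) (hr : 2 * r ≤ s), (endAlg.toHom u).range = ((isRiemannForm_siegelForm hδ Z.2).isNSForm.lefschetzSummandSubHodgeStructure (siegelPeriodEquiv hδ Z.2) r (Nat.add_sub_cancel' hr))} :=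
  dense_compl_hodgeGroupExceptionalLocus.mono fun _ hZ _ hs ↦
    ⟨existsUnique_isPrimitiveDecomposition_endAlg_hodgeStructure_siegelPeriodEquiv_one_of_le_two_mul_of_not_mem_hodgeGroupExceptionalLocus hg hδ hZ hs, fun _ hT _ hu ↦
      exists_range_toHom_eq_lefschetzSummandSubHodgeStructure_siegelPeriodEquiv_of_mem_isPrimitiveDecomposition_endAlg_of_not_mem_hodgeGroupExceptionalLocus hg hδ hZ hs hT hu⟩

/-- **THE `Z ∈ 𝔥_g` FOR WHICH EVERY `Hˢ(X^δ_Z, ℚ)` (`s ≤ 2g`) HAS EXACTLY `2^(⌊min(s, 2g−s)/2⌋ + 1)` SUB-HODGE STRUCTURES ARE DENSE.** [cite: Lange2023AbelianVarietiesComplex, §7.3.1 Prop. 7.3.2 (p0336 L7–L21) and §7.3.2 (1)–(3) (p0338)]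
[cite: CarlsonMullerStachPeters2017, §15.2 Lemma 15.2.7] -/
theorem dense_setOf_forall_natCard_subHodgeStructure_hodgeStructure_siegelPeriodEquiv {δ : Fin g → ℕ} (hδ : ∀ i, 0 < δ i) :
    Dense {Z : siegelUpperHalfSpace g | ∀ s ≤ 2 * g, Nat.card (SubHodgeStructure (hodgeStructure (siegelPeriodEquiv hδ Z.2) s)) = 2 ^ (min s (2 * g - s) / 2 + 1)} :=
  dense_compl_hodgeGroupExceptionalLocus.mono fun _ hZ _ hs ↦ natCard_subHodgeStructure_hodgeStructure_siegelPeriodEquiv_of_not_mem_hodgeGroupExceptionalLocus hδ hZ hs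

/-- **PROP. 7.3.2 AS PRINTED — «FOR A GENERAL `Z ∈ 𝔥_g`» = OFF A MEAGRE SET: the `Z` for which `h(X^δ_Z)` has a unique decomposition into simple Hodge motives with `#KunnemannIndex(g)`
members (in every positively oriented ring frame), and, for every `s ≤ 2g`, `End_Hdg(Hˢ(X^δ_Z, ℚ)) ≅ ℚ^{⌊min(s, 2g−s)/2⌋+1}`, `Hˢ(X^δ_Z, ℚ)` has a unique decomposition into indecomposable
sub-Hodge structures and exactly `2^(⌊min(s, 2g−s)/2⌋ + 1)` sub-Hodge structures, form a RESIDUAL (comeagre) subset of `𝔥_g`** (`g ≥ 1`; A4 `compl_hodgeGroupExceptionalLocus_mem_residual`: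
"general" = outside a countable union of proper analytic subsets, p0336 L7–L20). [cite: Lange2023AbelianVarietiesComplex, §7.3.1 Prop. 7.3.2 (p0336 L7–L21) and its proof (p0337)] [cite: Lange2023AbelianVarietiesComplex, §7.3.1 Prop. 7.3.2 (p0336), §3.6 Thm. 3.6.1, §7.2.2 Thm. 7.2.4 (p0331) and §7.3.2 (1)–(3) (p0338 L3–L16)] [cite: Lam2001FirstCourse, §22 Prop. (22.1), p. 325] [cite: Kahn2020, §3.5.2 Prop. 3.45, §6.7 Thm. 6.20 and §6.12.2 Cor. 6.42] [cite: VoisinHodgeI2002, §7.1.2 and §7.3.1 Cor. 7.24] [cite: Kunnemann1993] -/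
theorem eventually_residual_existsUnique_isPrimitiveDecomposition_siegelPeriodEquiv (hg : 0 < g) {δ : Fin g → ℕ} (hδ : ∀ i, 0 < δ i) :
    ∀ᶠ Z in residual (siegelUpperHalfSpace g),
      (∀ (f : Fin (g + g) ≃ Fin g ⊕ Fin g) (hf : orientationSign (siegelPeriodEquiv hδ Z.2) f = 1) (f' : Fin ((g + g) + (g + g)) ≃ (Fin g ⊕ Fin g) ⊕ (Fin g ⊕ Fin g)),
        (∃! T : Finset (CorrRing.hodgeCorr (siegelPeriodEquiv hδ Z.2) f hf f'), IsPrimitiveDecomposition T 1) ∧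
          ∀ T : Finset (CorrRing.hodgeCorr (siegelPeriodEquiv hδ Z.2) f hf f'), IsPrimitiveDecomposition T 1 → T.card = Fintype.card (KunnemannIndex g)) ∧
      ∀ s ≤ 2 * g, Nonempty ((hodgeStructure (siegelPeriodEquiv hδ Z.2) s).endAlg ≃ₐ[ℚ] (Fin (min s (2 * g - s) / 2 + 1) → ℚ)) ∧
        (∃! T : Finset (hodgeStructure (siegelPeriodEquiv hδ Z.2) s).endAlg, IsPrimitiveDecomposition T 1) ∧
          Nat.card (SubHodgeStructure (hodgeStructure (siegelPeriodEquiv hδ Z.2) s)) = 2 ^ (min s (2 * g - s) / 2 + 1) :=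
  Filter.eventually_of_mem compl_hodgeGroupExceptionalLocus_mem_residual fun _ hZ ↦
    ⟨fun f hf f' ↦ ⟨existsUnique_isPrimitiveDecomposition_hodgeCorr_siegelPeriodEquiv_one_of_not_mem_hodgeGroupExceptionalLocus hg hδ hZ f hf f', fun _ hT ↦
        card_eq_card_kunnemannIndex_of_isPrimitiveDecomposition_hodgeCorr_siegelPeriodEquiv_one_of_not_mem_hodgeGroupExceptionalLocus hg hδ hZ f hf f' hT⟩,
      fun _ hs ↦ ⟨nonempty_endAlg_hodgeStructure_siegelPeriodEquiv_algEquiv_pi_of_le_two_mul_of_not_mem_hodgeGroupExceptionalLocus hg hδ hZ hs,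
        existsUnique_isPrimitiveDecomposition_endAlg_hodgeStructure_siegelPeriodEquiv_one_of_le_two_mul_of_not_mem_hodgeGroupExceptionalLocus hg hδ hZ hs,
        natCard_subHodgeStructure_hodgeStructure_siegelPeriodEquiv_of_not_mem_hodgeGroupExceptionalLocus hδ hZ hs⟩⟩

end ComplexTorusCat

end Literature.AlgebraicGeometry.HodgeTheory

end
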